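/-
Copyright (c) 2026 the pub-hodgecm-mathlib formalisation cell (harness21).  Prover seat hodgecm-mathlib-R90-CS-p03 (g4), Track B ∕ R90-TF, h413 = `stmt-HodgeConjecture-24833`,
R90-TF section S8 «ContSpec-n½», socket (E) :276, E1-PLANCHEREL BODY brick «PB-BOX» (S8 dealer R90-CS-plan (g4) S8-R302 (3); census `CENSUS-PBBOX-TauBoxBound.CS-p03-g4.md`
cf3ffa0421737c65): the BOX-BOUND letter `hbox` of ★ p865367 `K2E1PseudoEisensteinEntryLettersOfExports.entry_hB_of_boxBounds` — the continued scattering coordinates of every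
`K_∞`-finite τ-admissible generator are UNIFORMLY BOUNDED on `{1 < Re z ≤ σ₀, |Im z| ≥ 1}` — read off ★ p865359's Gram-model engine GLOBALLY (the engine's constant depends only on
`sup (Re z − 1)`, `inf |Im z|`, `a = κ‖φ|_K‖²` and `T = 1`).
-/
import Summits.HodgeConjecture.HodgeConjecture.Theorems.R90S8ResGMidTauOffAxisBoundOfGramU3    -- ★ p865359 (K2E3-p29 (g4)): `hPreal_row_of_truncatedExportsRow` (§3.3) and everything its §3.1 assembly uses (★ FILE 2a `bracket_le_of_chiFourTerm_offAxis`, `l2Model_of_columns`; ★ p865213; ★ p865131 `hTEXP6_row_of_ports`)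
import HarnessLib

/-!
# S8 (E) PB-BOX — `R90S8ResGMidTauBoxBoundOfGramU3`: the continued scattering coordinates of every `K_∞`-finite τ-admissible generator are UNIFORMLY BOUNDED on the box
# `{1 < Re z ≤ σ₀, |Im z| ≥ 1}` [MW95 IV.3.12 (a)] — the `hbox` letter of ★ PB-2d `entry_hB_of_boxBounds`

Track B ∕ R90-TF, crux h413 = `stmt-HodgeConjecture-24833`, route of record `HCCMUnconditional`; cell `hodgecm-mathlib`, R90-TF section S8 «ContSpec-n½», socket (E) (B :276), E1-PLANCHEREL
BODY: ★ PB-2d (p865367, K2E1-p12 (g7)) reduced the strip bound `hB` of the vector contour shift ★ PB-2a′ to PER-COORDINATE BOX BOUNDS `‖qc_j^{(a)}(z)‖ ≤ B_q` on `{κ < Re z ≤ σ₀, |Im z| ≥ 1}`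
(`κ = 1` for `U(2,1)`); THIS FILE PAYS THEM for the τ-row of record (the currency `(ι, φ', qv, qcv, Pv)` + NF clause of ★ p865131 ∕ ★ p865359).  THEOREMS ONLY (no `def`, no `instance`,
no `notation`, no named-fact hypothesis, no `sorry`; default heartbeats); lane `--supports stmt-HodgeConjecture-24833 --as helper` (count-neutral).  CLOSES NO SOCKET.

THE MATHEMATICS ([MoeglinWaldspurger1995, IV.2.3, IV.3.12 (a)]; [Langlands1976, §7]; [Arthur1980TraceFormulaII, §4]).  Everything is ★ p865359's §3.1 assembly (`hOFFBD_of_truncatedExportsRow`)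
READ GLOBALLY.  For a τ-admissible generator `φ` with column data `(ι, φ', qv, qcv, Pv)`, the exports-with-(E6) row gives `Ec`, a closed co-discrete `P₆` and the truncated `L²`-family
`Fam` at `T = 1`; ★ `exists_scalars_of_coords_global` the continued scalars `wc`, `Bc`; in the `L²(K_max)`-model (★ `l2Model_of_columns`) the fourth bracket is `Bc z z = κ·N(z)` with
`N(z) = ∫_K ‖Σ_j qcv_j(z) φ'_j‖²`, `‖wc z‖² ≤ a·κN(z)` (`a = κ·∫_K ‖φ‖²`) and `‖qcv_j(z)‖² ≤ C₀·N(z)`.  On the quarter domains `D^± ∖ (P₆ ∪ Pv)` the diagonal identity ★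
`normSq_family_eq_chiFourTerm_of_tube` (∕ `…_lower_of_tube`) holds, and the pure engine ★ `bracket_le_of_chiFourTerm_offAxis` bounds `κN(z)` by
`M(x₂, η, a, T) = (x₂T^{2x₂}√a∕η + √(x₂²T^{4x₂}a∕η² + aT^{4x₂}))²` whenever `Re z − 1 ∈ [x₁, x₂]` (`x₁ > 0`) and `|Im z| ≥ η`.  THE POINT: `x₁ := Re z − 1` may be chosen POINTWISE and
`T = 1` is FIXED, so with `x₂ := σ₀`, `η := ½` ONE constant `M` serves the whole ENLARGED box `{1 < Re z ≤ σ₀ + 1, |Im z| ≥ ½}` off `P₆ ∪ Pv`: there `‖qcv_j(z)‖ ≤ B := √(C₀·M∕κ)` (§2,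
`hglob`).  AT the (co-discrete) exceptional points of the target box `{1 < Re ≤ σ₀, |Im| ≥ 1}` the same bound holds by continuity: ★ `hPreal_row_of_truncatedExportsRow` (p865359 §3.3, the
NF clause) makes every `qcv_j` analytic at every off-axis point of `{1 < Re}`, the enlarged box is a neighbourhood of the target box, and a punctured neighbourhood avoids `P₆ ∪ Pv`
(`le_of_tendsto` along `𝓝[≠] z`).  No `T`-bookkeeping, no new letter.
* §1 (pure) `norm_le_sqrt_of_sq_le_mul` (the coordinate bound from the bracket bound), `boxBound_of_finite_family` (finitely many generators: one constant — PB-2d's `hbox` bytes).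
* §2 HEAD **`hBOX_row_of_truncatedExportsRow (μ νG hβ μK νI h𝓕I ξ μω) (hμu) (hquad) (hTEXP6)`** ⊢ for the τ-row binders of ★ p865359 :115–:130 VERBATIM:
  `∀ σ₀, ∃ B, ∀ j z, 1 < z.re → z.re ≤ σ₀ → 1 ≤ |z.im| → ‖qcv j z‖ ≤ B`; **`hBOX_row_of_ports (… hμZ μa μf …) (hCO′)`** — (E6) discharged by ★ p865131 `hTEXP6_row_of_ports`.
VISIBLE (exactly ★ p865359's): (F) `μ νG β hβ μZ hμZ` + Borel structures, (F′) `μa μf`, (F″) a Maass–Selberg frame `μK νI 𝓕I` (the conclusion does not depend on it), (U) `hμu`, (Q) `hquad`,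
(L′) `hCO′` (resp. `hTEXP6`).
HONEST LABEL: HC_CM is proved only modulo the 7 printed citations (2 remaining named inputs: hLiu418 = `stmt-HodgeConjecture-24832`, h413 = `stmt-HodgeConjecture-24833`) until
rung 0 closes; PB-BOX = ★ modulo (F)(F′)(F″)(U)(Q)(L′) (no new letter); pays no socket; REL ≠ ★ ≠ BUILT; count-neutral.

## References
* [MoeglinWaldspurger1995] C. Mœglin, J.-L. Waldspurger, *Spectral Decomposition and Eisenstein Series* (1995), IV.2.3, IV.3.12 (a) (Maass–Selberg inequality on the positive chamber).
* [Langlands1976] R. P. Langlands, *On the Functional Equations Satisfied by Eisenstein Series*, LNM 544 (1976), §7.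
* [Arthur1980TraceFormulaII] J. Arthur, *A trace formula for reductive groups II*, Compositio Math. 40 (1980), §4.
* [Iwaniec2002] H. Iwaniec, *Spectral Methods of Automorphic Forms* (2nd ed., 2002), §6.3, §7 p. 103 (the scalar model of the bound).
-/

set_option autoImplicit false
set_option linter.dupNamespace false  -- the mandated namespace `…HodgeConjecture.HodgeConjecture.R90.S8` (LEAD #1 L1) repeats the summit's segment

noncomputable section

open MeasureTheory Measure NumberField IsDedekindDomain Set Filter Topology ContRepresentation Complex
open scoped ENNReal NNReal ComplexConjugate InnerProductSpace Topology
open Literature.NumberTheory Literature.NumberTheory.Automorphic Literature.NumberTheory.Automorphic.UnitaryGroup Literature.NumberTheory.GaloisRepresentations AdelicGroupData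
open Literature.NumberTheory.Automorphic.Arthur2013.Leaves.TECR Literature.NumberTheory.Rogawski1990 Literature.NumberTheory.LFunctions Literature.MeasureTheory.Group
open Summit.HodgeConjecture.HodgeConjecture.Cruxes.H413.K2E1BorelEisensteinU Summit.HodgeConjecture.HodgeConjecture.Cruxes.H413.K2E1CharacterEisensteinU2Defs
open Summit.HodgeConjecture.HodgeConjecture.Cruxes.H413.K2E1CharacterEisensteinU3PairDefs Summit.HodgeConjecture.HodgeConjecture.Cruxes.H413.K2E1ChiSectionSpaceU3PairDefs
open Summit.HodgeConjecture.HodgeConjecture.Cruxes.H413.K2E1BLBorelSpacesU2Defs Summit.HodgeConjecture.HodgeConjecture.Cruxes.H413.K2E1BLBorelOperatorsU2Defs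
open Summit.HodgeConjecture.HodgeConjecture.Cruxes.H413.R90S8ResGMidBlockScatteringOfRecordU3 (integrable_restrict_mul_conj_of_bounded)
open Summit.HodgeConjecture.HodgeConjecture.Cruxes.H413.K2E1ChiMaassSelbergOnAxisScalarsOfRecordCMThree (exists_scalars_of_coords_global)
open Summit.HodgeConjecture.HodgeConjecture.Cruxes.H413.K2E1ChiMaassSelbergDiagonalCMThree (normSq_family_eq_chiFourTerm_of_tube normSq_family_eq_chiFourTerm_lower_of_tube)
open Summit.HodgeConjecture.HodgeConjecture.Cruxes.H413.K2E1ChiEisensteinRealAxisPoleLedgerOfExportsCMThree (quarterDomains_of_codiscrete)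
open Summit.HodgeConjecture.HodgeConjecture.Cruxes.H413.K2E1ChiMaassSelbergTubeFreeCMThree (chiTube_threeScalars_uniform_free)
open Summit.HodgeConjecture.HodgeConjecture.Cruxes.H413.K2E1MaassSelbergSphericalBracketsCMThree (idelicBracket_pos)
open Summit.HodgeConjecture.HodgeConjecture.Cruxes.H413.K2E1ChiScatteringCoordsEulerFactorisationCMThree (linearIndependent_restrict_comap_of_isChiSectionPair)

namespace Summit.HodgeConjecture.HodgeConjecture.R90.S8

/-! ## §1 Pure bookkeeping -/

/-- From `‖q‖² ≤ C₀·N`, `κ·N ≤ M` (`κ > 0`, `C₀ ≥ 0`): `‖q‖ ≤ √(C₀·(M∕κ))`. [folklore] -/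
theorem norm_le_sqrt_of_sq_le_mul {q : ℂ} {C₀ N κ M : ℝ} (hC₀ : 0 ≤ C₀) (hκ : 0 < κ) (hq : ‖q‖ ^ 2 ≤ C₀ * N) (hN : κ * N ≤ M) :
    ‖q‖ ≤ Real.sqrt (C₀ * (M / κ)) := by
  have hNle : N ≤ M / κ := by rw [le_div_iff₀ hκ, mul_comm]; exact hN
  calc ‖q‖ = Real.sqrt (‖q‖ ^ 2) := (Real.sqrt_sq (norm_nonneg _)).symm
    _ ≤ Real.sqrt (C₀ * (M / κ)) := Real.sqrt_le_sqrt (hq.trans (mul_le_mul_of_nonneg_left hNle hC₀))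

/-- **FINITELY MANY GENERATORS, ONE CONSTANT**: per-generator box bounds `∀ a, ∃ B_a, ∀ j z, … → ‖qc a j z‖ ≤ B_a` give one `B_q` for all `(a, j)` — the `hbox` bytes of ★ PB-2d
`K2E1PseudoEisensteinEntryLettersOfExports.entry_hB_of_boxBounds`. [folklore] -/
theorem boxBound_of_finite_family {α ι : Type*} [Fintype α] (qc : α → ι → ℂ → ℂ) {κ σ₀ : ℝ}
    (h : ∀ a, ∃ B : ℝ, ∀ j, ∀ z : ℂ, κ < z.re → z.re ≤ σ₀ → 1 ≤ |z.im| → ‖qc a j z‖ ≤ B) :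
    ∃ Bq : ℝ, ∀ a j, ∀ z : ℂ, κ < z.re → z.re ≤ σ₀ → 1 ≤ |z.im| → ‖qc a j z‖ ≤ Bq := by
  choose B hB using h
  refine ⟨∑ a, max (B a) 0, fun a j z h₁ h₂ h₃ => (hB a j z h₁ h₂ h₃).trans ((le_max_left (B a) 0).trans ?_)⟩
  exact Finset.single_le_sum (f := fun a => max (B a) 0) (fun a _ => le_max_right _ _) (Finset.mem_univ a)

/-! ## §2 HEAD: the uniform box bound for every `K_∞`-finite τ-admissible generator -/

section Row

variable (L : Type) [Field L] [NumberField L] [IsCMField L]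
  [MeasurableSpace (quasiSplit (↥(maximalRealSubfield L)) L (IsCMField.complexConj L) 3).Adelic] [BorelSpace (quasiSplit (↥(maximalRealSubfield L)) L (IsCMField.complexConj L) 3).Adelic]
  [MeasurableSpace ↥(arch (↥(maximalRealSubfield L)) L (IsCMField.complexConj L) 3 ((StdForm.antidiagonal 3).over L))] [BorelSpace ↥(arch (↥(maximalRealSubfield L)) L (IsCMField.complexConj L) 3 ((StdForm.antidiagonal 3).over L))] [MeasurableSpace ↥(finAdelic (↥(maximalRealSubfield L)) L (IsCMField.complexConj L) 3 ((StdForm.antidiagonal 3).over L))] [BorelSpace ↥(finAdelic (↥(maximalRealSubfield L)) L (IsCMField.complexConj L) 3 ((StdForm.antidiagonal 3).over L))]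
  [MeasurableSpace (AdeleRing (𝓞 L) L)ˣ] [BorelSpace (AdeleRing (𝓞 L) L)ˣ]
  (μ : Measure (quasiSplit (↥(maximalRealSubfield L)) L (IsCMField.complexConj L) 3).automorphicQuotient) [(quasiSplit (↥(maximalRealSubfield L)) L (IsCMField.complexConj L) 3).IsAutomorphicMeasure μ]
  (νG : Measure (quasiSplit (↥(maximalRealSubfield L)) L (IsCMField.complexConj L) 3).Adelic) [νG.IsHaarMeasure] [νG.IsInvInvariant] [SFinite νG]
  {β : (quasiSplit (↥(maximalRealSubfield L)) L (IsCMField.complexConj L) 3).Adelic → ℝ≥0∞}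
  (hβ : IsCoveringWeight ↥((arithmeticBorel (↥(maximalRealSubfield L)) L (IsCMField.complexConj L) 3).map (quasiSplit (↥(maximalRealSubfield L)) L (IsCMField.complexConj L) 3).arithmeticSubgroup.subtype) β)
  {μZ : Measure (borelQuotient (↥(maximalRealSubfield L)) L (IsCMField.complexConj L) 3)} [SFinite μZ]
  (hμZ : ∀ f : borelQuotient (↥(maximalRealSubfield L)) L (IsCMField.complexConj L) 3 → ℝ≥0∞, Measurable f → ∫⁻ z, f z ∂μZ = ∫⁻ g, β g * f (toBorelQuotient (↥(maximalRealSubfield L)) L (IsCMField.complexConj L) 3 g) ∂νG)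
  (μa : Measure ↥(arch (↥(maximalRealSubfield L)) L (IsCMField.complexConj L) 3 ((StdForm.antidiagonal 3).over L))) [μa.IsHaarMeasure] [μa.IsMulRightInvariant]
  (μf : Measure ↥(finAdelic (↥(maximalRealSubfield L)) L (IsCMField.complexConj L) 3 ((StdForm.antidiagonal 3).over L))) [μf.IsHaarMeasure]
  -- (F″) a Maass–Selberg frame: Haar measures on `K_max` and on the ideles, an idele-class domain (the conclusions do not depend on them)
  (μK : Measure ↥((standardMaximalCompactGL 3 L).comap (adelicVal (↥(maximalRealSubfield L)) L (IsCMField.complexConj L) 3 ((StdForm.antidiagonal 3).over L)) : Subgroup (quasiSplit (↥(maximalRealSubfield L)) L (IsCMField.complexConj L) 3).Adelic)) [μK.IsHaarMeasure]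
  (νI : Measure (AdeleRing (𝓞 L) L)ˣ) [νI.IsHaarMeasure] {𝓕I : Set (AdeleRing (𝓞 L) L)ˣ} (h𝓕I : IsIdeleClassDomain L 𝓕I)
  (ξ : OneDimAutRepH L) (μω : HeckeCharacter L)

omit [MeasurableSpace ↥(arch (↥(maximalRealSubfield L)) L (IsCMField.complexConj L) 3 ((StdForm.antidiagonal 3).over L))] [BorelSpace ↥(arch (↥(maximalRealSubfield L)) L (IsCMField.complexConj L) 3 ((StdForm.antidiagonal 3).over L))] [MeasurableSpace ↥(finAdelic (↥(maximalRealSubfield L)) L (IsCMField.complexConj L) 3 ((StdForm.antidiagonal 3).over L))] [BorelSpace ↥(finAdelic (↥(maximalRealSubfield L)) L (IsCMField.complexConj L) 3 ((StdForm.antidiagonal 3).over L))] [SFinite νG] in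
include νG hβ μK νI h𝓕I in
/-- **HEAD — `hBOX_row_of_truncatedExportsRow`: THE CONTINUED SCATTERING COORDINATES OF EVERY `K_∞`-FINITE τ-ADMISSIBLE GENERATOR ARE UNIFORMLY BOUNDED ON `{1 < Re z ≤ σ₀, |Im z| ≥ 1}`**
(the Maass–Selberg inequality on the positive chamber, [MW95 IV.3.12 (a)]) — from `hμu`, `hquad`, the exports-with-(E6) τ-row `hTEXP6` (hypothesis-first) and a Maass–Selberg frame (F″);
binders = ★ p865359 `hOFFBD_of_truncatedExportsRow` :115–:130 VERBATIM, conclusion `∀ σ₀, ∃ B, ∀ j z, 1 < z.re → z.re ≤ σ₀ → 1 ≤ |z.im| → ‖qcv j z‖ ≤ B`.  Proof: module docstring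
(★ p865359's engine read with `x₁ := Re z − 1` pointwise, `x₂ := σ₀`, `η := ½`, `T = 1` on the enlarged box off `P₆ ∪ Pv`; the exceptional points by continuity from ★ `hPreal_row_…`).
[cite: MoeglinWaldspurger1995, IV.2.3, IV.3.12 (a)] [cite: Langlands1976, §7] [cite: Arthur1980TraceFormulaII, §4] -/
theorem hBOX_row_of_truncatedExportsRow (hμu : μω.IsUnitary)
    (hquad : ∀ x : ideleGroup ↥(maximalRealSubfield L), μω (AdeleRing.ideleBaseChange (↥(maximalRealSubfield L)) L x) = quadraticHeckeCharCM L x)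
    (hTEXP6 : ∀ (U₀ : Subgroup ↥(finAdelic (↥(maximalRealSubfield L)) L (IsCMField.complexConj L) 3 ((StdForm.antidiagonal 3).over L))) (_ : IsTauLevel L U₀)
      (φ : (quasiSplit (↥(maximalRealSubfield L)) L (IsCMField.complexConj L) 3).Adelic → ℂ) (_ : φ ∈ chiSectionSpacePair (ξ.bcη⁻¹ * ξ.bcψ⁻¹ * μω) ξ.ψ (tauLevel L U₀) ((1 : ↥(tauLevel L U₀) →* ℂ) : ↥(tauLevel L U₀) → ℂ)) (_ : Continuous φ)
      (_ : IsArchFinite L φ)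
      (ν : Measure ↥(adelicUnipotent (↥(maximalRealSubfield L)) L (IsCMField.complexConj L) 3)) (_ : ν.IsHaarMeasure) (𝓕 : Set ↥(adelicUnipotent (↥(maximalRealSubfield L)) L (IsCMField.complexConj L) 3))
      (_ : IsFundamentalDomain ↥(rationalUnipotent (↥(maximalRealSubfield L)) L (IsCMField.complexConj L) 3) 𝓕 ν) (_ : IsCompact (closure 𝓕)) (_ : ν.IsInvInvariant) (_ : ν 𝓕 = 1),
      ∃ (Ec' : ℂ → (quasiSplit (↥(maximalRealSubfield L)) L (IsCMField.complexConj L) 3).Adelic → ℂ) (P : Set ℂ), IsClosed P ∧ (∀ z₀ : ℂ, ∀ᶠ s in 𝓝[≠] z₀, s ∉ P) ∧ (∀ z ∈ P, z.re ≤ 2) ∧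
        (∀ z : ℂ, 2 < z.re → Ec' z = eisensteinSeriesU (flatSectionU φ z)) ∧ (∀ g (z : ℂ), z ∉ P → AnalyticAt ℂ (fun z => Ec' z g) z) ∧
        (∀ z : ℂ, z ∉ P → Continuous (Ec' z)) ∧
        (∀ z₁ : ℂ, z₁ ∉ P → ∀ K : Set (quasiSplit (↥(maximalRealSubfield L)) L (IsCMField.complexConj L) 3).Adelic, IsCompact K → ∃ V ∈ 𝓝 z₁, ∃ M : ℝ, ∀ z ∈ V, ∀ g ∈ K, ‖Ec' z g‖ ≤ M) ∧
        (∀ T : ℝ≥0, 1 ≤ T → ∃ Fam : ℂ → Lp ℂ 2 μ, DifferentiableOn ℂ Fam Pᶜ ∧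
          ∀ z : ℂ, z ∉ P → ((Fam z : Lp ℂ 2 μ) : (quasiSplit (↥(maximalRealSubfield L)) L (IsCMField.complexConj L) 3).automorphicQuotient → ℂ) =ᵐ[μ]
            (quasiSplit (↥(maximalRealSubfield L)) L (IsCMField.complexConj L) 3).quotFun (truncation ν 𝓕 T (Ec' z)))) :
    ∀ (U₀ : Subgroup ↥(finAdelic (↥(maximalRealSubfield L)) L (IsCMField.complexConj L) 3 ((StdForm.antidiagonal 3).over L))) (_ : IsTauLevel L U₀)
      (φ : (quasiSplit (↥(maximalRealSubfield L)) L (IsCMField.complexConj L) 3).Adelic → ℂ) (_ : φ ∈ chiSectionSpacePair (ξ.bcη⁻¹ * ξ.bcψ⁻¹ * μω) ξ.ψ (tauLevel L U₀) ((1 : ↥(tauLevel L U₀) →* ℂ) : ↥(tauLevel L U₀) → ℂ)) (_ : Continuous φ)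
      (_ : IsArchFinite L φ)
      (ν : Measure ↥(adelicUnipotent (↥(maximalRealSubfield L)) L (IsCMField.complexConj L) 3)) (_ : ν.IsHaarMeasure) (𝓕 : Set ↥(adelicUnipotent (↥(maximalRealSubfield L)) L (IsCMField.complexConj L) 3))
      (_ : IsFundamentalDomain ↥(rationalUnipotent (↥(maximalRealSubfield L)) L (IsCMField.complexConj L) 3) 𝓕 ν) (_ : IsCompact (closure 𝓕)) (_ : ν.IsInvInvariant) (_ : ν 𝓕 = 1),
      ∀ (ι : Type) [Fintype ι] (φ' : ι → (quasiSplit (↥(maximalRealSubfield L)) L (IsCMField.complexConj L) 3).Adelic → ℂ) (qv qcv : ι → ℂ → ℂ) (Pv : Set ℂ),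
        LinearIndependent ℂ φ' →
        (∀ j, IsChiSectionPair (reflectChar (IsCMField.complexConj L) (ξ.bcη⁻¹ * ξ.bcψ⁻¹ * μω)) ξ.ψ (φ' j)) →
        (∀ j, Continuous (φ' j)) →
        (∀ j, ∃ C : ℝ, ∀ x, ‖φ' j x‖ ≤ C) →
        (∀ z : ℂ, 2 < z.re → (∑ j, qv j z • φ' j) = ((((ν 𝓕).toReal⁻¹ : ℝ)) : ℂ) • (fun g : (quasiSplit (↥(maximalRealSubfield L)) L (IsCMField.complexConj L) 3).Adelic => (∫ v : ↥(adelicUnipotent (↥(maximalRealSubfield L)) L (IsCMField.complexConj L) 3), flatSectionU φ z ((quasiSplit (↥(maximalRealSubfield L)) L (IsCMField.complexConj L) 3).toAdelic (weylLongU ((IsCMField.complexConj L : L ≃ₐ[↥(maximalRealSubfield L)] L) : L →+* L) (rfl : (StdForm.antidiagonal 3).over L = (StdForm.antidiagonal 3).over L)) * ((v : (quasiSplit (↥(maximalRealSubfield L)) L (IsCMField.complexConj L) 3).Adelic) * g)) ∂ν) * (((borelHeight g : ℝ) : ℂ) ^ (z - 2)))) →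
        (∀ z₀ : ℂ, ∀ᶠ s in 𝓝[≠] z₀, s ∉ Pv) →
        (∀ z ∈ Pv, z.re ≤ 2) →
        (∀ j (z : ℂ), z ∉ Pv → AnalyticAt ℂ (qcv j) z) →
        (∀ j (z : ℂ), 2 < z.re → qcv j z = qv j z) →
        (∀ j, MeromorphicNFOn (qcv j) univ) →
      ∀ σ₀ : ℝ, ∃ B : ℝ, ∀ j (z : ℂ), 1 < z.re → z.re ≤ σ₀ → 1 ≤ |z.im| → ‖qcv j z‖ ≤ B := by
  intro U₀ hU₀ φ hφV hφc hφa ν hν 𝓕 h𝓕N h𝓕c hνi hν1 ι _ φ' qv qcv Pv hli hb hφ'c hφ'bd hqφ hPvcd hPvre hqcvP hqcvq hNF σ₀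
  classical
  -- off the real axis in `{1 < Re}` every coordinate is analytic (★ p865359 §3.3, the NF clause)
  have hanal : ∀ j (z : ℂ), 1 < z.re → z.im ≠ 0 → AnalyticAt ℂ (qcv j) z :=
    hPreal_row_of_truncatedExportsRow L μ νG hβ μK νI h𝓕I ξ μω hμu hquad hTEXP6 U₀ hU₀ φ hφV hφc hφa ν hν 𝓕 h𝓕N h𝓕c hνi hν1 ι φ' qv qcv Pv hli hb hφ'c hφ'bd hqφ hPvcd hPvre
      hqcvP hqcvq hNF
  -- ★ p865359 §3.1, SETUP VERBATIM: the block character, `φ` bounded, the columns bounded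
  have hχ₁u : ((ξ.bcη⁻¹ * ξ.bcψ⁻¹ * μω)).IsUnitary := isUnitary_blockChar L ξ μω hμu (norm_eta_apply_eq_one L ξ) (norm_psi_apply_eq_one L ξ)
  have hρ₁ : ∀ r : ℝ≥0ˣ, ((ξ.bcη⁻¹ * ξ.bcψ⁻¹ * μω)) (posRealIdele L r) = 1 := midBlockChar_posRealIdele L ξ μω hquad
  have hφ : IsChiSectionPair (ξ.bcη⁻¹ * ξ.bcψ⁻¹ * μω) ξ.ψ φ := isChiSectionPair_of_mem hφV
  obtain ⟨Cφ, hφC⟩ := exists_norm_le_of_isChiSectionPair L hχ₁u (norm_psi_apply_eq_one L ξ) hφ hφc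
  have hCb := hφ'bd
  choose Cb hCb' using hCb
  -- (E6) at `T = 1`
  obtain ⟨Ec, P₆, hP₆c, hP₆cd, -, hE2, -, -, -, hE6⟩ := hTEXP6 U₀ hU₀ φ hφV hφc hφa ν hν 𝓕 h𝓕N h𝓕c hνi hν1
  obtain ⟨Fam, hFd, hFam⟩ := hE6 1 le_rfl
  -- (L2) the continued scalars off `Pv` (closed by co-discreteness) with their closed formulas
  have hPvc : IsClosed Pv := isClosed_of_codiscrete hPvcd
  obtain ⟨wc, Bc, hwc, hwagree, hBc1, hBc2, hBagree, hwcf, hBcf⟩ := exists_scalars_of_coords_global L μK νI 𝓕I ν hν1 (ξ.bcη⁻¹ * ξ.bcψ⁻¹ * μω) φ φ' hqφ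
    (fun j => differentiableOn_compl_of_analyticAt_off (hqcvP j)) hqcvq hPvc
    (fun j => integrable_restrict_mul_conj_of_bounded L μK (hφ'c j) hφc (hCb' j) hφC)
    (fun j l => integrable_restrict_mul_conj_of_bounded L μK (hφ'c j) (hφ'c l) (hCb' j) (hCb' l))
  -- the joint pole set `P := P₆ ∪ Pv`
  have hPc : IsClosed (P₆ ∪ Pv) := hP₆c.union hPvc
  have hPcd : ∀ w : ℂ, ∀ᶠ s in 𝓝[≠] w, s ∉ P₆ ∪ Pv := fun w => ((hP₆cd w).and (hPvcd w)).mono fun s hs h => h.elim hs.1 hs.2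
  have h6 : (P₆ ∪ Pv)ᶜ ⊆ P₆ᶜ := compl_subset_compl.2 subset_union_left
  have hv : (P₆ ∪ Pv)ᶜ ⊆ Pvᶜ := compl_subset_compl.2 subset_union_right
  -- the `L²(K_max)`-model of the columns
  obtain ⟨C₀, hC₀, hmodel⟩ := l2Model_of_columns L μK hφ'c hφ'bd (linearIndependent_restrict_comap_of_isChiSectionPair L hli hb) hφc hφC
  -- `κ = ∫ ‖x‖ dν_I > 0`, its complex avatar, and `|I_χ| ≤ κ`
  have hκ : 0 < (∫ x in {x : (AdeleRing (𝓞 L) L)ˣ | (IdeleClassGroup.ideleNorm L x : ℝ) ≤ 1} ∩ 𝓕I, (IdeleClassGroup.ideleNorm L x : ℝ) ∂νI) := idelicBracket_pos νI h𝓕I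
  have hκC : (∫ x in {x : (AdeleRing (𝓞 L) L)ˣ | (IdeleClassGroup.ideleNorm L x : ℝ) ≤ 1} ∩ 𝓕I, ((IdeleClassGroup.ideleNorm L x : ℝ) : ℂ) ∂νI) = (((∫ x in {x : (AdeleRing (𝓞 L) L)ˣ | (IdeleClassGroup.ideleNorm L x : ℝ) ≤ 1} ∩ 𝓕I, (IdeleClassGroup.ideleNorm L x : ℝ) ∂νI) : ℝ) : ℂ) := integral_ofReal
  have hIχ : ‖(∫ x in {x : (AdeleRing (𝓞 L) L)ˣ | (IdeleClassGroup.ideleNorm L x : ℝ) ≤ 1} ∩ 𝓕I, ((IdeleClassGroup.ideleNorm L x : ℝ) : ℂ) * (((reflectChar (IsCMField.complexConj L) (ξ.bcη⁻¹ * ξ.bcψ⁻¹ * μω) x : ℂˣ) : ℂ) * conj (((ξ.bcη⁻¹ * ξ.bcψ⁻¹ * μω) x : ℂˣ) : ℂ)) ∂νI)‖ ≤ (∫ x in {x : (AdeleRing (𝓞 L) L)ˣ | (IdeleClassGroup.ideleNorm L x : ℝ) ≤ 1} ∩ 𝓕I, (IdeleClassGroup.ideleNorm L x : ℝ) ∂νI)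 := by
    refine (norm_integral_le_integral_norm _).trans (le_of_eq ?_)
    refine integral_congr_ae (Eventually.of_forall fun x => ?_)
    have h1 : ‖(((reflectChar (IsCMField.complexConj L) (ξ.bcη⁻¹ * ξ.bcψ⁻¹ * μω) x : ℂˣ) : ℂ))‖ = 1 := (IsUnitary.reflectChar hχ₁u) x
    have h2 : ‖conj (((ξ.bcη⁻¹ * ξ.bcψ⁻¹ * μω) x : ℂˣ) : ℂ)‖ = 1 := by rw [Complex.norm_conj]; exact hχ₁u x
    show ‖((IdeleClassGroup.ideleNorm L x : ℝ) : ℂ) * ((((reflectChar (IsCMField.complexConj L) (ξ.bcη⁻¹ * ξ.bcψ⁻¹ * μω) x : ℂˣ) : ℂ)) * conj (((ξ.bcη⁻¹ * ξ.bcψ⁻¹ * μω) x : ℂˣ) : ℂ))‖ = (IdeleClassGroup.ideleNorm L x : ℝ)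
    rw [norm_mul, norm_mul, h1, h2, mul_one, mul_one, Complex.norm_of_nonneg (NNReal.coe_nonneg _)]
  -- the brackets of the identity in the model: `Bc z z = κ·N z` (real `≥ 0`), `‖wc z‖² ≤ a·(κ N z)`, the coordinates dominated by `N z`
  have hN0 : ∀ z : ℂ, 0 ≤ (∫ k, ‖∑ j, qcv j z * φ' j (k : (quasiSplit (↥(maximalRealSubfield L)) L (IsCMField.complexConj L) 3).Adelic)‖ ^ 2 ∂μK) := fun z => integral_nonneg fun k => sq_nonneg _
  have hBcz : ∀ z : ℂ, Bc z z = ((((∫ x in {x : (AdeleRing (𝓞 L) L)ˣ | (IdeleClassGroup.ideleNorm L x : ℝ) ≤ 1} ∩ 𝓕I, (IdeleClassGroup.ideleNorm L x : ℝ) ∂νI) * (∫ k, ‖∑ j, qcv j z * φ' j (k : (quasiSplit (↥(maximalRealSubfield L)) L (IsCMField.complexConj L) 3).Adelic)‖ ^ 2 ∂μK) : ℝ)) : ℂ) := fun z => by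
    have hmz := (hmodel (fun j => qcv j z)).1
    beta_reduce at hmz
    rw [hBcf z z, hκC, hmz]
    push_cast
    ring
  have hwcz : ∀ z : ℂ, ‖wc z‖ ^ 2 ≤ ((∫ x in {x : (AdeleRing (𝓞 L) L)ˣ | (IdeleClassGroup.ideleNorm L x : ℝ) ≤ 1} ∩ 𝓕I, (IdeleClassGroup.ideleNorm L x : ℝ) ∂νI) * (∫ k, ‖φ (k : (quasiSplit (↥(maximalRealSubfield L)) L (IsCMField.complexConj L) 3).Adelic)‖ ^ 2 ∂μK)) * ((∫ x in {x : (AdeleRing (𝓞 L) L)ˣ | (IdeleClassGroup.ideleNorm L x : ℝ) ≤ 1} ∩ 𝓕I, (IdeleClassGroup.ideleNorm L x : ℝ) ∂νI) * (∫ k, ‖∑ j, qcv j z * φ' j (k : (quasiSplit (↥(maximalRealSubfield L)) L (IsCMField.complexConj L) 3).Adelic)‖ ^ 2 ∂μK)) := fun z => by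
    have hcs := (hmodel (fun j => qcv j z)).2.2.1
    beta_reduce at hcs
    rw [hwcf z, norm_mul, mul_pow]
    have hI2 : ‖(∫ x in {x : (AdeleRing (𝓞 L) L)ˣ | (IdeleClassGroup.ideleNorm L x : ℝ) ≤ 1} ∩ 𝓕I, ((IdeleClassGroup.ideleNorm L x : ℝ) : ℂ) * (((reflectChar (IsCMField.complexConj L) (ξ.bcη⁻¹ * ξ.bcψ⁻¹ * μω) x : ℂˣ) : ℂ) * conj (((ξ.bcη⁻¹ * ξ.bcψ⁻¹ * μω) x : ℂˣ) : ℂ)) ∂νI)‖ ^ 2 ≤ (∫ x in {x : (AdeleRing (𝓞 L) L)ˣ | (IdeleClassGroup.ideleNorm L x : ℝ) ≤ 1} ∩ 𝓕I, (IdeleClassGroup.ideleNorm L x : ℝ) ∂νI) ^ 2 := pow_le_pow_left₀ (norm_nonneg _) hIχ 2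
    calc ‖∑ j, qcv j z * ∫ k, φ' j (k : (quasiSplit (↥(maximalRealSubfield L)) L (IsCMField.complexConj L) 3).Adelic) * conj (φ (k : (quasiSplit (↥(maximalRealSubfield L)) L (IsCMField.complexConj L) 3).Adelic)) ∂μK‖ ^ 2 * ‖(∫ x in {x : (AdeleRing (𝓞 L) L)ˣ | (IdeleClassGroup.ideleNorm L x : ℝ) ≤ 1} ∩ 𝓕I, ((IdeleClassGroup.ideleNorm L x : ℝ) : ℂ) * (((reflectChar (IsCMField.complexConj L) (ξ.bcη⁻¹ * ξ.bcψ⁻¹ * μω) x : ℂˣ) : ℂ) * conj (((ξ.bcη⁻¹ * ξ.bcψ⁻¹ * μω) x : ℂˣ) : ℂ)) ∂νI)‖ ^ 2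
        ≤ ((∫ k, ‖φ (k : (quasiSplit (↥(maximalRealSubfield L)) L (IsCMField.complexConj L) 3).Adelic)‖ ^ 2 ∂μK) * (∫ k, ‖∑ j, qcv j z * φ' j (k : (quasiSplit (↥(maximalRealSubfield L)) L (IsCMField.complexConj L) 3).Adelic)‖ ^ 2 ∂μK)) * (∫ x in {x : (AdeleRing (𝓞 L) L)ˣ | (IdeleClassGroup.ideleNorm L x : ℝ) ≤ 1} ∩ 𝓕I, (IdeleClassGroup.ideleNorm L x : ℝ) ∂νI) ^ 2 := mul_le_mul hcs hI2 (sq_nonneg _) (mul_nonneg (integral_nonneg fun k => sq_nonneg _) (hN0 z))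
      _ = ((∫ x in {x : (AdeleRing (𝓞 L) L)ˣ | (IdeleClassGroup.ideleNorm L x : ℝ) ≤ 1} ∩ 𝓕I, (IdeleClassGroup.ideleNorm L x : ℝ) ∂νI) * (∫ k, ‖φ (k : (quasiSplit (↥(maximalRealSubfield L)) L (IsCMField.complexConj L) 3).Adelic)‖ ^ 2 ∂μK)) * ((∫ x in {x : (AdeleRing (𝓞 L) L)ˣ | (IdeleClassGroup.ideleNorm L x : ℝ) ≤ 1} ∩ 𝓕I, (IdeleClassGroup.ideleNorm L x : ℝ) ∂νI) * (∫ k, ‖∑ j, qcv j z * φ' j (k : (quasiSplit (↥(maximalRealSubfield L)) L (IsCMField.complexConj L) 3).Adelic)‖ ^ 2 ∂μK)) := by ring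
  have hqN : ∀ (z : ℂ) (j : ι), ‖qcv j z‖ ^ 2 ≤ C₀ * (∫ k, ‖∑ j, qcv j z * φ' j (k : (quasiSplit (↥(maximalRealSubfield L)) L (IsCMField.complexConj L) 3).Adelic)‖ ^ 2 ∂μK) := fun z j => by
    have h := (hmodel (fun j => qcv j z)).2.2.2 j
    beta_reduce at h
    exact h
  have ha0 : 0 ≤ (∫ x in {x : (AdeleRing (𝓞 L) L)ˣ | (IdeleClassGroup.ideleNorm L x : ℝ) ≤ 1} ∩ 𝓕I, (IdeleClassGroup.ideleNorm L x : ℝ) ∂νI) * (∫ k, ‖φ (k : (quasiSplit (↥(maximalRealSubfield L)) L (IsCMField.complexConj L) 3).Adelic)‖ ^ 2 ∂μK) := mul_nonneg hκ.le (integral_nonneg fun k => sq_nonneg _)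
  -- the quarter domains off `P₆ ∪ Pv`, the tube identity with uniform constants, the Maass–Selberg pairing on the sub-tubes
  obtain ⟨⟨hD₁, hD₁c, hD₁sub, ⟨O₁, O₂', hO₁, hO₁ne, hO₁D, hO₂', hO₂'ne, hO₂'D, hsep⟩, -⟩, ⟨hD₂, hD₂c, hD₂sub, ⟨Q₁, Q₂', hQ₁, hQ₁ne, hQ₁D, hQ₂', hQ₂'ne, hQ₂'D, hsep₂⟩, -⟩⟩ :=
    quarterDomains_of_codiscrete hPc hPcd one_lt_two
  have hFtube : ∀ D : Set ℂ, D ⊆ (P₆ ∪ Pv)ᶜ → ∀ z ∈ D, 2 < z.re → ((Fam z : Lp ℂ 2 μ) : (quasiSplit (↥(maximalRealSubfield L)) L (IsCMField.complexConj L) 3).automorphicQuotient → ℂ) =ᵐ[μ]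
      (quasiSplit (↥(maximalRealSubfield L)) L (IsCMField.complexConj L) 3).quotFun (truncation ν 𝓕 1 (eisensteinSeriesU (flatSectionU φ z))) := fun D hD z hz hz2 => by
    rw [← hE2 z hz2]; exact hFam z (h6 (hD hz))
  have hD₁P : ((({z : ℂ | 1 < z.re} ∩ {z : ℂ | 0 < z.im}) ∩ univ) \ (P₆ ∪ Pv)) ⊆ (P₆ ∪ Pv)ᶜ := fun z hz => hz.2
  have hD₂P : ((({z : ℂ | 1 < z.re} ∩ {z : ℂ | z.im < 0}) ∩ univ) \ (P₆ ∪ Pv)) ⊆ (P₆ ∪ Pv)ᶜ := fun z hz => hz.2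
  obtain ⟨Cμ, CK, hCμ, hCK, hU⟩ := chiTube_threeScalars_uniform_free L μ νG μK νI h𝓕I ν h𝓕N hν1 h𝓕c hβ (le_refl (1 : ℝ≥0)) hχ₁u hρ₁ (norm_psi_apply_eq_one L ξ) ξ.hψ hφc hφ hφC
  have hMStube : ∀ {D : Set ℂ}, (∀ z ∈ D, 2 < z.re → ((Fam z : Lp ℂ 2 μ) : (quasiSplit (↥(maximalRealSubfield L)) L (IsCMField.complexConj L) 3).automorphicQuotient → ℂ) =ᵐ[μ] (quasiSplit (↥(maximalRealSubfield L)) L (IsCMField.complexConj L) 3).quotFun (truncation ν 𝓕 1 (eisensteinSeriesU (flatSectionU φ z)))) →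
      ∀ z ∈ D, ∀ z' ∈ D, 2 < z'.re → z'.re < z.re →
      ⟪Fam z', Fam z⟫_ℂ = ((Cμ : ℝ) : ℂ) * (((CK : ℝ) : ℂ) *
        ((((((1 : ℝ≥0) : ℝ)) : ℂ) ^ (z + conj z' - 2) / (z + conj z' - 2)) * (((((∫ x in {x : (AdeleRing (𝓞 L) L)ˣ | (IdeleClassGroup.ideleNorm L x : ℝ) ≤ 1} ∩ 𝓕I, (IdeleClassGroup.ideleNorm L x : ℝ) ∂νI) * (∫ k, ‖φ (k : (quasiSplit (↥(maximalRealSubfield L)) L (IsCMField.complexConj L) 3).Adelic)‖ ^ 2 ∂μK))) : ℝ) : ℂ)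
          + (((((1 : ℝ≥0) : ℝ)) : ℂ) ^ (z - conj z') / (z - conj z')) * conj (wc z')
          - (((((1 : ℝ≥0) : ℝ)) : ℂ) ^ (-(z - conj z')) / (z - conj z')) * wc z
          - (((((1 : ℝ≥0) : ℝ)) : ℂ) ^ (-(z + conj z' - 2)) / (z + conj z' - 2)) * Bc z z')) := by
    intro D hFt z hz z' hz' h1 h2
    rw [hU Fam hFt z hz z' hz' h1 h2, hwagree z (h1.trans h2), hwagree z' h1, hBagree z z' (h1.trans h2) h1]
  have hT0 : (0 : ℝ) < ((1 : ℝ≥0) : ℝ) := by norm_num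
  -- THE GLOBAL READING: one engine constant on the enlarged box `{1 < Re ≤ σ₀ + 1, |Im| ≥ ½}` off `P₆ ∪ Pv` (`x₁ := Re z − 1` pointwise, `x₂ := σ₀`, `η := ½`, `T = 1`)
  have hηpos : (0 : ℝ) < 1 / 2 := by norm_num
  have hglob : ∀ z : ℂ, z ∉ P₆ ∪ Pv → 1 < z.re → z.re ≤ σ₀ + 1 → 1 / 2 ≤ |z.im| → ∀ j,
      ‖qcv j z‖ ≤ Real.sqrt (C₀ * ((σ₀ * ((1 : ℝ≥0) : ℝ) ^ (2 * σ₀) * Real.sqrt ((∫ x in {x : (AdeleRing (𝓞 L) L)ˣ | (IdeleClassGroup.ideleNorm L x : ℝ) ≤ 1} ∩ 𝓕I, (IdeleClassGroup.ideleNorm L x : ℝ) ∂νI) * (∫ k, ‖φ (k : (quasiSplit (↥(maximalRealSubfield L)) L (IsCMField.complexConj L) 3).Adelic)‖ ^ 2 ∂μK)) / (1 / 2) +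
        Real.sqrt (σ₀ ^ 2 * ((1 : ℝ≥0) : ℝ) ^ (4 * σ₀) * ((∫ x in {x : (AdeleRing (𝓞 L) L)ˣ | (IdeleClassGroup.ideleNorm L x : ℝ) ≤ 1} ∩ 𝓕I, (IdeleClassGroup.ideleNorm L x : ℝ) ∂νI) * (∫ k, ‖φ (k : (quasiSplit (↥(maximalRealSubfield L)) L (IsCMField.complexConj L) 3).Adelic)‖ ^ 2 ∂μK)) / (1 / 2) ^ 2 + ((∫ x in {x : (AdeleRing (𝓞 L) L)ˣ | (IdeleClassGroup.ideleNorm L x : ℝ) ≤ 1} ∩ 𝓕I, (IdeleClassGroup.ideleNorm L x : ℝ) ∂νI) * (∫ k, ‖φ (k : (quasiSplit (↥(maximalRealSubfield L)) L (IsCMField.complexConj L) 3).Adelic)‖ ^ 2 ∂μK)) * ((1 : ℝ≥0) : ℝ) ^ (4 * σ₀))) ^ 2 /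
        (∫ x in {x : (AdeleRing (𝓞 L) L)ˣ | (IdeleClassGroup.ideleNorm L x : ℝ) ≤ 1} ∩ 𝓕I, (IdeleClassGroup.ideleNorm L x : ℝ) ∂νI))) := by
    intro z hzP hxz hzσ hzη j
    have hyz : z.im ≠ 0 := fun h => by rw [h, abs_zero] at hzη; linarith
    have hx₁pos : 0 < z.re - 1 := by linarith
    have hxI : z.re - 1 ∈ Set.Icc (z.re - 1) σ₀ := ⟨le_rfl, by linarith⟩
    -- the fourth bracket `κ·N z` is bounded by the engine constant (upper quarter plane directly, lower via the reflected identity at `conj z`)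
    have hbz : (∫ x in {x : (AdeleRing (𝓞 L) L)ˣ | (IdeleClassGroup.ideleNorm L x : ℝ) ≤ 1} ∩ 𝓕I, (IdeleClassGroup.ideleNorm L x : ℝ) ∂νI) * (∫ k, ‖∑ j, qcv j z * φ' j (k : (quasiSplit (↥(maximalRealSubfield L)) L (IsCMField.complexConj L) 3).Adelic)‖ ^ 2 ∂μK) ≤ (σ₀ * ((1 : ℝ≥0) : ℝ) ^ (2 * σ₀) * Real.sqrt ((∫ x in {x : (AdeleRing (𝓞 L) L)ˣ | (IdeleClassGroup.ideleNorm L x : ℝ) ≤ 1} ∩ 𝓕I, (IdeleClassGroup.ideleNorm L x : ℝ) ∂νI) * (∫ k, ‖φ (k : (quasiSplit (↥(maximalRealSubfield L)) L (IsCMField.complexConj L) 3).Adelic)‖ ^ 2 ∂μK)) / (1 / 2) +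
        Real.sqrt (σ₀ ^ 2 * ((1 : ℝ≥0) : ℝ) ^ (4 * σ₀) * ((∫ x in {x : (AdeleRing (𝓞 L) L)ˣ | (IdeleClassGroup.ideleNorm L x : ℝ) ≤ 1} ∩ 𝓕I, (IdeleClassGroup.ideleNorm L x : ℝ) ∂νI) * (∫ k, ‖φ (k : (quasiSplit (↥(maximalRealSubfield L)) L (IsCMField.complexConj L) 3).Adelic)‖ ^ 2 ∂μK)) / (1 / 2) ^ 2 + ((∫ x in {x : (AdeleRing (𝓞 L) L)ˣ | (IdeleClassGroup.ideleNorm L x : ℝ) ≤ 1} ∩ 𝓕I, (IdeleClassGroup.ideleNorm L x : ℝ) ∂νI) * (∫ k, ‖φ (k : (quasiSplit (↥(maximalRealSubfield L)) L (IsCMField.complexConj L) 3).Adelic)‖ ^ 2 ∂μK)) * ((1 : ℝ≥0) : ℝ) ^ (4 * σ₀))) ^ 2 := by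
      rcases lt_or_gt_of_ne hyz with hneg | hpos
      · -- lower half-plane: the reflected identity at `u := conj z`
        have hzD : conj (conj z) ∈ ((({z : ℂ | 1 < z.re} ∩ {z : ℂ | z.im < 0}) ∩ univ) \ (P₆ ∪ Pv)) := by
          rw [Complex.conj_conj]; exact ⟨⟨⟨hxz, hneg⟩, mem_univ _⟩, hzP⟩
        have hid := normSq_family_eq_chiFourTerm_lower_of_tube hD₂ hD₂c hD₂sub hQ₁ hQ₁ne hQ₁D hQ₂' hQ₂'ne hQ₂'D hsep₂ Cμ CK _ hT0 (hwc.mono (hD₂P.trans hv))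
          (fun z' _ => (hBc1 z').mono (hD₂P.trans hv)) (fun z _ => (hBc2 z).mono fun u hu h => hu.2 (Or.inr h)) Fam (hFd.mono (hD₂P.trans h6)) (hMStube (hFtube _ hD₂P)) hzD
        have hB₃ : conj (wc (conj (conj z))) = conj (conj (conj (wc (conj (conj z))))) := by simp only [Complex.conj_conj]
        have hB₄ : conj (Bc (conj (conj z)) (conj (conj z))) = ((((∫ x in {x : (AdeleRing (𝓞 L) L)ˣ | (IdeleClassGroup.ideleNorm L x : ℝ) ≤ 1} ∩ 𝓕I, (IdeleClassGroup.ideleNorm L x : ℝ) ∂νI) * (∫ k, ‖∑ j, qcv j z * φ' j (k : (quasiSplit (↥(maximalRealSubfield L)) L (IsCMField.complexConj L) 3).Adelic)‖ ^ 2 ∂μK) : ℝ)) : ℂ) := by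
          rw [Complex.conj_conj, hBcz z, Complex.conj_ofReal]
        have hW : ‖conj (conj (wc (conj (conj z))))‖ ^ 2 ≤ ((∫ x in {x : (AdeleRing (𝓞 L) L)ˣ | (IdeleClassGroup.ideleNorm L x : ℝ) ≤ 1} ∩ 𝓕I, (IdeleClassGroup.ideleNorm L x : ℝ) ∂νI) * (∫ k, ‖φ (k : (quasiSplit (↥(maximalRealSubfield L)) L (IsCMField.complexConj L) 3).Adelic)‖ ^ 2 ∂μK)) * ((∫ x in {x : (AdeleRing (𝓞 L) L)ˣ | (IdeleClassGroup.ideleNorm L x : ℝ) ≤ 1} ∩ 𝓕I, (IdeleClassGroup.ideleNorm L x : ℝ) ∂νI) * (∫ k, ‖∑ j, qcv j z * φ' j (k : (quasiSplit (↥(maximalRealSubfield L)) L (IsCMField.complexConj L) 3).Adelic)‖ ^ 2 ∂μK)) := by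
          simp only [Complex.conj_conj]; exact hwcz z
        have hxI' : (conj z).re - 1 ∈ Set.Icc (z.re - 1) σ₀ := by rw [Complex.conj_re]; exact hxI
        have hyη : 1 / 2 ≤ |(conj z).im| := by rw [Complex.conj_im, abs_neg]; exact hzη
        exact bracket_le_of_chiFourTerm_offAxis hCμ hCK (by norm_num) (by rw [Complex.conj_re]; exact hxz) (by rw [Complex.conj_im]; exact neg_ne_zero.2 hyz)
          (sq_nonneg _) ha0 (mul_nonneg hκ.le (hN0 z)) hW hB₃ hB₄ hid hx₁pos hxI' hηpos hyη
      · -- upper half-plane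
        have hzD : z ∈ ((({z : ℂ | 1 < z.re} ∩ {z : ℂ | 0 < z.im}) ∩ univ) \ (P₆ ∪ Pv)) := ⟨⟨⟨hxz, hpos⟩, mem_univ _⟩, hzP⟩
        have hid := normSq_family_eq_chiFourTerm_of_tube hD₁ hD₁c hD₁sub hO₁ hO₁ne hO₁D hO₂' hO₂'ne hO₂'D hsep Cμ CK _ hT0 (hwc.mono (hD₁P.trans hv))
          (fun z' _ => (hBc1 z').mono (hD₁P.trans hv)) (fun z _ => (hBc2 z).mono fun u hu h => hu.2 (Or.inr h)) Fam (hFd.mono (hD₁P.trans h6)) (hMStube (hFtube _ hD₁P)) hzD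
        have hW : ‖conj (wc z)‖ ^ 2 ≤ ((∫ x in {x : (AdeleRing (𝓞 L) L)ˣ | (IdeleClassGroup.ideleNorm L x : ℝ) ≤ 1} ∩ 𝓕I, (IdeleClassGroup.ideleNorm L x : ℝ) ∂νI) * (∫ k, ‖φ (k : (quasiSplit (↥(maximalRealSubfield L)) L (IsCMField.complexConj L) 3).Adelic)‖ ^ 2 ∂μK)) * ((∫ x in {x : (AdeleRing (𝓞 L) L)ˣ | (IdeleClassGroup.ideleNorm L x : ℝ) ≤ 1} ∩ 𝓕I, (IdeleClassGroup.ideleNorm L x : ℝ) ∂νI) * (∫ k, ‖∑ j, qcv j z * φ' j (k : (quasiSplit (↥(maximalRealSubfield L)) L (IsCMField.complexConj L) 3).Adelic)‖ ^ 2 ∂μK)) := by rw [Complex.norm_conj]; exact hwcz z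
        exact bracket_le_of_chiFourTerm_offAxis hCμ hCK (by norm_num) hxz hyz (sq_nonneg _) ha0 (mul_nonneg hκ.le (hN0 z)) hW (Complex.conj_conj _).symm (hBcz z) hid
          hx₁pos hxI hηpos hzη
    exact norm_le_sqrt_of_sq_le_mul hC₀ hκ (hqN z j) hbz
  -- THE TARGET BOX: every point is an off-axis point of `{1 < Re}` (analyticity, ★ §3.3), the enlarged box is a neighbourhood, a punctured neighbourhood avoids `P₆ ∪ Pv`
  obtain ⟨B, hB⟩ : ∃ B : ℝ, ∀ z : ℂ, z ∉ P₆ ∪ Pv → 1 < z.re → z.re ≤ σ₀ + 1 → 1 / 2 ≤ |z.im| → ∀ j, ‖qcv j z‖ ≤ B := ⟨_, hglob⟩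
  refine ⟨B, fun j z hxz hzσ hzη => le_of_tendsto (((hanal j z hxz ?_).continuousAt.norm).continuousWithinAt (s := {z}ᶜ)).tendsto ?_⟩
  · intro h
    rw [h, abs_zero] at hzη
    linarith
  · have h1 : ∀ᶠ w : ℂ in 𝓝 z, 1 < w.re := (Complex.continuous_re.tendsto z).eventually (lt_mem_nhds hxz)
    have h2 : ∀ᶠ w : ℂ in 𝓝 z, w.re < σ₀ + 1 := (Complex.continuous_re.tendsto z).eventually (gt_mem_nhds (by linarith))
    have h3 : ∀ᶠ w : ℂ in 𝓝 z, 1 / 2 < |w.im| :=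
      ((continuous_abs.comp Complex.continuous_im).tendsto z).eventually (lt_mem_nhds (show (1 : ℝ) / 2 < |z.im| by linarith))
    filter_upwards [hPcd z, mem_nhdsWithin_of_mem_nhds h1, mem_nhdsWithin_of_mem_nhds h2, mem_nhdsWithin_of_mem_nhds h3] with w hwP hw1 hw2 hw3
    exact hB w hwP hw1 hw2.le hw3.le j

include μ νG hβ hμZ μa μf μK νI h𝓕I in
/-- **`hBOX_row_of_ports`**: the same uniform box bound with (E6) DISCHARGED by ★ p865131 `hTEXP6_row_of_ports` (visible: frames (F)(F′)(F″), `hμu`, `hquad`, `hCO′`) — the `hbox` letter of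
★ PB-2d for every `K_∞`-finite τ-admissible generator of the ports. [cite: MoeglinWaldspurger1995, IV.3.12 (a)] [cite: BernsteinLapid2019, Thm 2.3, §4] -/
theorem hBOX_row_of_ports (hμu : μω.IsUnitary)
    (hquad : ∀ x : ideleGroup ↥(maximalRealSubfield L), μω (AdeleRing.ideleBaseChange (↥(maximalRealSubfield L)) L x) = quadraticHeckeCharCM L x)
    (hCO : ∀ (W₀ : Submodule ℂ ((quasiSplit (↥(maximalRealSubfield L)) L (IsCMField.complexConj L) 3).Adelic → ℂ)) (hW₀K : ∀ k : ↥(archMaximalCompact L), ∀ ψ ∈ W₀, ((rightTranslation (quasiSplit (↥(maximalRealSubfield L)) L (IsCMField.complexConj L) 3)).comp (archMaximalCompact L).subtype) k ψ ∈ W₀) (_ : FiniteDimensional ℂ ↥W₀)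
      (_ : ∀ ψ ∈ W₀, IsChiSectionPair (ξ.bcη⁻¹ * ξ.bcψ⁻¹ * μω) ξ.ψ ψ) (_ : ∀ ψ ∈ W₀, Continuous ψ) (_ : (Subrepresentation.toRepresentation (⟨W₀, hW₀K⟩ : Subrepresentation ((rightTranslation (quasiSplit (↥(maximalRealSubfield L)) L (IsCMField.complexConj L) 3)).comp (archMaximalCompact L).subtype))).IsIrreducible),
      ∃ l₀ : ↥W₀ →ₗ[ℂ] ℂ, ∀ l : ↥W₀ →ₗ[ℂ] ℂ,
        (∀ (m : ↥(arch (↥(maximalRealSubfield L)) L (IsCMField.complexConj L) 3 ((StdForm.antidiagonal 3).over L))) (hmB : (archToAdelic (↥(maximalRealSubfield L)) L (IsCMField.complexConj L) 3 ((StdForm.antidiagonal 3).over L)) m ∈ borelAdelic (↥(maximalRealSubfield L)) L (IsCMField.complexConj L) 3) (hmK : (adelicVal (↥(maximalRealSubfield L)) L (IsCMField.complexConj L) 3 ((StdForm.antidiagonal 3).over L)) ((archToAdelic (↥(maximalRealSubfield L)) L (IsCMField.complexConj L) 3 ((StdForm.antidiagonal 3).over L)) m) ∈ standardMaximalCompactGL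 3 L) (w : ↥W₀),
          l ((Subrepresentation.toRepresentation (⟨W₀, hW₀K⟩ : Subrepresentation ((rightTranslation (quasiSplit (↥(maximalRealSubfield L)) L (IsCMField.complexConj L) 3)).comp (archMaximalCompact L).subtype))) ⟨(archToAdelic (↥(maximalRealSubfield L)) L (IsCMField.complexConj L) 3 ((StdForm.antidiagonal 3).over L)) m, archToAdelic_mem_archMaximalCompact L m hmK⟩ w) = ((((ξ.bcη⁻¹ * ξ.bcψ⁻¹ * μω)) (firstEntryUnit hmB) : ℂˣ) : ℂ) * (((ξ.ψ) (middleEntryUnitary hmB) : ℂˣ) : ℂ) * l w) →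
        ∃ a : ℂ, l = a • l₀) :
    ∀ (U₀ : Subgroup ↥(finAdelic (↥(maximalRealSubfield L)) L (IsCMField.complexConj L) 3 ((StdForm.antidiagonal 3).over L))) (_ : IsTauLevel L U₀)
      (φ : (quasiSplit (↥(maximalRealSubfield L)) L (IsCMField.complexConj L) 3).Adelic → ℂ) (_ : φ ∈ chiSectionSpacePair (ξ.bcη⁻¹ * ξ.bcψ⁻¹ * μω) ξ.ψ (tauLevel L U₀) ((1 : ↥(tauLevel L U₀) →* ℂ) : ↥(tauLevel L U₀) → ℂ)) (_ : Continuous φ)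
      (_ : IsArchFinite L φ)
      (ν : Measure ↥(adelicUnipotent (↥(maximalRealSubfield L)) L (IsCMField.complexConj L) 3)) (_ : ν.IsHaarMeasure) (𝓕 : Set ↥(adelicUnipotent (↥(maximalRealSubfield L)) L (IsCMField.complexConj L) 3))
      (_ : IsFundamentalDomain ↥(rationalUnipotent (↥(maximalRealSubfield L)) L (IsCMField.complexConj L) 3) 𝓕 ν) (_ : IsCompact (closure 𝓕)) (_ : ν.IsInvInvariant) (_ : ν 𝓕 = 1),
      ∀ (ι : Type) [Fintype ι] (φ' : ι → (quasiSplit (↥(maximalRealSubfield L)) L (IsCMField.complexConj L) 3).Adelic → ℂ) (qv qcv : ι → ℂ → ℂ) (Pv : Set ℂ),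
        LinearIndependent ℂ φ' →
        (∀ j, IsChiSectionPair (reflectChar (IsCMField.complexConj L) (ξ.bcη⁻¹ * ξ.bcψ⁻¹ * μω)) ξ.ψ (φ' j)) →
        (∀ j, Continuous (φ' j)) →
        (∀ j, ∃ C : ℝ, ∀ x, ‖φ' j x‖ ≤ C) →
        (∀ z : ℂ, 2 < z.re → (∑ j, qv j z • φ' j) = ((((ν 𝓕).toReal⁻¹ : ℝ)) : ℂ) • (fun g : (quasiSplit (↥(maximalRealSubfield L)) L (IsCMField.complexConj L) 3).Adelic => (∫ v : ↥(adelicUnipotent (↥(maximalRealSubfield L)) L (IsCMField.complexConj L) 3), flatSectionU φ z ((quasiSplit (↥(maximalRealSubfield L)) L (IsCMField.complexConj L) 3).toAdelic (weylLongU ((IsCMField.complexConj L : L ≃ₐ[↥(maximalRealSubfield L)] L) : L →+* L) (rfl : (StdForm.antidiagonal 3).over L = (StdForm.antidiagonal 3).over L)) * ((v : (quasiSplit (↥(maximalRealSubfield L)) L (IsCMField.complexConj L) 3).Adelic) * g)) ∂ν) * (((borelHeight g : ℝ) : ℂ) ^ (z - 2)))) →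
        (∀ z₀ : ℂ, ∀ᶠ s in 𝓝[≠] z₀, s ∉ Pv) →
        (∀ z ∈ Pv, z.re ≤ 2) →
        (∀ j (z : ℂ), z ∉ Pv → AnalyticAt ℂ (qcv j) z) →
        (∀ j (z : ℂ), 2 < z.re → qcv j z = qv j z) →
        (∀ j, MeromorphicNFOn (qcv j) univ) →
      ∀ σ₀ : ℝ, ∃ B : ℝ, ∀ j (z : ℂ), 1 < z.re → z.re ≤ σ₀ → 1 ≤ |z.im| → ‖qcv j z‖ ≤ B :=
  hBOX_row_of_truncatedExportsRow L μ νG hβ μK νI h𝓕I ξ μω hμu hquad (hTEXP6_row_of_ports L μ νG hβ hμZ μa μf ξ μω hμu hCO)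

end Row

end Summit.HodgeConjecture.HodgeConjecture.R90.S8

end
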